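import Summits.ValiantsHypothesis.ValiantsHypothesis.Theorems.BarrierLeverPartitionMinorsHitByVPAdditiveSplit
import Summits.ValiantsHypothesis.ValiantsHypothesis.Theorems.BarrierLeverPartitionMinorsBlockVandermonde

/-!
# Route BarrierLever — item `PartitionMinorsHitByVP` (stmt-ValiantsHypothesis-19717):
# BLOCK-CONTIGUOUS certificates — min-stratified rows × multi-run columns are hit

Helper file (`--supports stmt-ValiantsHypothesis-19717`; cell valiant-natproofs, rung V4, 𝒟-side door (c),
prover seat val-np-p1, gen 11). Closes NO item; definition-free. A third certificate type for the additive
door next to the CONTIGUOUS LEAF (`…PrimaryContiguous`) and the SPLIT NODE (`…AdditiveSplit`).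
**Setting.** Prime `p`, neutral set `Z`, weight `e`, an injective LABELLING `π : Fin h → ℕ` of the
coordinates; column weight `D j = Σ_{c ∈ w j \ Z} p^{e c}`, row label `ℓ i = min_{a ∈ u i} π a`. Under the
Frobenius table `X_(c,none) ↦ [c ∈ Z]`, `X_(c,some a) ↦ [c ∉ Z]·t^{(π a + 1) p^{e c}}` in `𝔽_p[t]` the integer
additive matrix becomes the generalized Vandermonde `[ξ_i^{D_j}]` of the code polynomials
`ξ_i = Σ_{a ∈ u i} t^{π a + 1} = t^{ℓ i + 1}(1 + t ρ_i)`, and `BlockVandermonde.det_pow_ne_zero_of_blocks` applies.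
**Theorem (`det_additiveZ_ne_zero_of_blockContiguous`, `partitionMinor_hit_of_blockContiguous`).** If a
bijection `β` (row ↦ column) makes the weights `D (β i)` distinct, DECREASING when the label `ℓ i` increases,
and within each label class of size `g` pairwise closer than `g` (every label class receives a RUN of `g`
consecutive weights — «the descending weights jump only at class boundaries»), the integer additive matrix is
nonsingular and the layout is hit in `SmallCircuits ℂ (h+h) 5` (`h ≥ 2`). Variants: `…₀` (one empty row,
matched to the weight-`0` column), `…_rows` (mirror), `…_sorted` (rows listed by label, columns by decreasing
weight, adjacent equal labels facing consecutive weights — no bijection to supply). Special cases: one run =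
the contiguous leaf; singleton classes = rows with distinct minimal labels × any distinct weights.
WHAT THIS IS NOT: the Frobenius table's true reach is larger (this is the provable skeleton); item 19717
stays open; nothing on CPM (20172/20195), crux 14610 or VP vs VNP.
-/

set_option linter.dupNamespace false

namespace Summit.ValiantsHypothesis.ValiantsHypothesis.Theorems.BarrierLever.SubsetSum

open Finset MvPolynomial Literature.Barriers.ValiantsHypothesis
open Summit.ValiantsHypothesis.ValiantsHypothesis.Theorems.BarrierLever.AdditiveDoor
  (partitionMinor_hit_of_additive_mem partitionMinor_hit_symm)
open Summit.ValiantsHypothesis.ValiantsHypothesis.Theorems.BarrierLever.BlockVandermonde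
  (det_pow_ne_zero_of_blocks det_pow_ne_zero_of_zero_row)

noncomputable section

variable {h : ℕ} {p : ℕ} [Fact p.Prime]

/-! ## 1. Labelled code polynomials `ξ_U = Σ_{a ∈ U} t^{π a + 1}` -/

/-- With an injective labelling, the coefficient of `t^{π a + 1}` in `ξ_U` is the indicator of `a ∈ U`. -/
theorem coeff_codePolyL (π : Fin h → ℕ) (hπ : Function.Injective π) (U : Finset (Fin h)) (a : Fin h) :
    (∑ b ∈ U, (Polynomial.X : Polynomial (ZMod p)) ^ (π b + 1)).coeff (π a + 1) =
      if a ∈ U then 1 else 0 := by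
  rw [Polynomial.finsetSum_coeff]
  simp_rw [Polynomial.coeff_X_pow]
  have key : ∀ b, (π a + 1 = π b + 1) ↔ (a = b) := fun b =>
    ⟨fun hab => hπ (by omega), fun hab => by rw [hab]⟩
  simp_rw [key]
  exact Finset.sum_ite_eq U a fun _ => 1

/-- The labelled code polynomial is injective in `U`. -/
theorem codePolyL_injective (π : Fin h → ℕ) (hπ : Function.Injective π) :
    Function.Injective fun U : Finset (Fin h) =>
      ∑ b ∈ U, (Polynomial.X : Polynomial (ZMod p)) ^ (π b + 1) := by
  intro U V hUV
  ext a
  have := congrArg (fun q => Polynomial.coeff q (π a + 1)) hUV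
  simp only [coeff_codePolyL π hπ] at this
  by_cases hU : a ∈ U <;> by_cases hV : a ∈ V <;> simp_all

/-- **Valuation form.** `ξ_U = t^{ℓ+1} (1 + t ρ_U)` with `ℓ` the least label in `U` and
`ρ_U = Σ_{a ∈ U, π a ≠ ℓ} t^{π a − ℓ − 1}`. -/
theorem codePolyL_eq (π : Fin h → ℕ) (hπ : Function.Injective π) (U : Finset (Fin h)) (hU : U.Nonempty)
    (ℓ : ℕ) (hℓ : U.inf' hU π = ℓ) :
    ∑ b ∈ U, (Polynomial.X : Polynomial (ZMod p)) ^ (π b + 1) =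
      Polynomial.X ^ (ℓ + 1) * (1 + Polynomial.X *
        ∑ b ∈ U.filter (fun b => π b ≠ ℓ), (Polynomial.X : Polynomial (ZMod p)) ^ (π b - ℓ - 1)) := by
  obtain ⟨a₀, ha₀, hπa₀⟩ := Finset.exists_mem_eq_inf' hU π
  rw [hℓ] at hπa₀
  have hfilter : U.filter (fun b => π b ≠ ℓ) = U.erase a₀ := by
    ext b
    simp only [Finset.mem_filter, Finset.mem_erase]
    constructor
    · rintro ⟨hb, hb'⟩
      exact ⟨fun h => hb' (by rw [h, hπa₀]), hb⟩
    · rintro ⟨hb', hb⟩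
      exact ⟨hb, fun h => hb' (hπ (by rw [h, ← hπa₀]))⟩
  have hgt : ∀ b ∈ U.erase a₀, ℓ + 1 ≤ π b := fun b hb => by
    have h1 : ℓ ≤ π b := by rw [← hℓ]; exact Finset.inf'_le π (Finset.mem_of_mem_erase hb)
    have h2 : π b ≠ ℓ := fun h => Finset.ne_of_mem_erase hb (hπ (by rw [h, ← hπa₀]))
    omega
  rw [hfilter, ← Finset.add_sum_erase U _ ha₀, mul_add, mul_one, ← hπa₀, Finset.mul_sum, Finset.mul_sum]
  congr 1
  refine Finset.sum_congr rfl fun b hb => ?_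
  rw [← mul_assoc, ← pow_succ, ← pow_add]
  congr 1
  have := hgt b hb
  rw [hπa₀]
  omega

/-! ## 2. The labelled Frobenius table modulo `p` -/

/-- Frobenius additivity in characteristic `p` with a neutral set and a labelling. -/
theorem frobL_lin (Z : Finset (Fin h)) (e : Fin h → ℕ) (π : Fin h → ℕ) (c : Fin h) (U : Finset (Fin h)) :
    eval₂Hom (Int.castRingHom (Polynomial (ZMod p)))
        (fun q : Fin h × Option (Fin h) =>
          Option.elim q.2 (if q.1 ∈ Z then 1 else 0) fun a =>
            if q.1 ∈ Z then 0 else (Polynomial.X : Polynomial (ZMod p)) ^ ((π a + 1) * p ^ e q.1))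
        (X (c, none) + ∑ a ∈ U, X (c, some a) : MvPolynomial (Fin h × Option (Fin h)) ℤ) =
      if c ∈ Z then 1 else (∑ b ∈ U, (Polynomial.X : Polynomial (ZMod p)) ^ (π b + 1)) ^ p ^ e c := by
  simp only [map_add, map_sum, coe_eval₂Hom, eval₂_X, Option.elim]
  split_ifs with hc
  · simp
  · rw [zero_add, sum_pow_char_pow p (e c) U]
    refine Finset.sum_congr rfl fun k _ => ?_
    rw [← pow_mul]

/-- The evaluated entry is `ξ_U^(Σ_{c ∈ W \ Z} p^{e c})`. -/
theorem frobL_entry (Z : Finset (Fin h)) (e : Fin h → ℕ) (π : Fin h → ℕ) (U W : Finset (Fin h)) :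
    eval₂Hom (Int.castRingHom (Polynomial (ZMod p)))
        (fun q : Fin h × Option (Fin h) =>
          Option.elim q.2 (if q.1 ∈ Z then 1 else 0) fun a =>
            if q.1 ∈ Z then 0 else (Polynomial.X : Polynomial (ZMod p)) ^ ((π a + 1) * p ^ e q.1))
        (∏ c ∈ W, (X (c, none) + ∑ a ∈ U, X (c, some a)) : MvPolynomial (Fin h × Option (Fin h)) ℤ) =
      (∑ b ∈ U, (Polynomial.X : Polynomial (ZMod p)) ^ (π b + 1)) ^ (∑ c ∈ W \ Z, p ^ e c) := by
  rw [map_prod, ← Finset.prod_pow_eq_pow_sum, Finset.sdiff_eq_filter, Finset.prod_filter]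
  refine Finset.prod_congr rfl fun c _ => ?_
  rw [frobL_lin]
  split_ifs <;> rfl

/-! ## 3. Block-contiguous certificates -/

/-- **BLOCK-CONTIGUOUS CERTIFICATE ⇒ the integer additive matrix is nonsingular** (`ι`-indexed). Data: prime
`p`, neutral `Z`, weight `e`, injective labelling `π`; column weights `D j = Σ_{c ∈ w j \ Z} p^{e c}`, row labels
`ℓ i = min_{a ∈ u i} π a` (`u` injective, rows nonempty); a bijection `β` (row ↦ column) with `D ∘ β`
injective, decreasing in the label, and inside each label class of size `g` pairwise closer than `g`. -/
theorem det_additiveZ_ne_zero_of_blockContiguous (p : ℕ) [Fact p.Prime] {ι : Type*} [Fintype ι]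
    [DecidableEq ι] (u w : ι → Finset (Fin h)) (hu : Function.Injective u) (hne : ∀ i, (u i).Nonempty)
    (Z : Finset (Fin h)) (e : Fin h → ℕ) (π : Fin h → ℕ) (hπ : Function.Injective π)
    (D : ι → ℕ) (hw : ∀ j, ∑ c ∈ w j \ Z, p ^ e c = D j)
    (ℓ : ι → ℕ) (hℓ : ∀ i, (u i).inf' (hne i) π = ℓ i) (β : ι ≃ ι)
    (hD : Function.Injective D)
    (hlt : ∀ i i', ℓ i < ℓ i' → D (β i') < D (β i))
    (heq : ∀ i i', ℓ i = ℓ i' → D (β i) < D (β i') + Fintype.card {k // ℓ k = ℓ i}) :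
    (Matrix.of fun i j : ι =>
      (∏ c ∈ w j, (X (c, none) + ∑ a ∈ u i, X (c, some a)) :
        MvPolynomial (Fin h × Option (Fin h)) ℤ)).det ≠ 0 := by
  let ψ : MvPolynomial (Fin h × Option (Fin h)) ℤ →+* Polynomial (ZMod p) :=
    eval₂Hom (Int.castRingHom (Polynomial (ZMod p)))
      (fun q : Fin h × Option (Fin h) =>
        Option.elim q.2 (if q.1 ∈ Z then 1 else 0) fun a =>
          if q.1 ∈ Z then 0 else (Polynomial.X : Polynomial (ZMod p)) ^ ((π a + 1) * p ^ e q.1))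
  let ξ : Finset (Fin h) → Polynomial (ZMod p) := fun U =>
    ∑ b ∈ U, (Polynomial.X : Polynomial (ZMod p)) ^ (π b + 1)
  let ρ : ι → Polynomial (ZMod p) := fun i =>
    ∑ b ∈ (u i).filter (fun b => π b ≠ ℓ i), (Polynomial.X : Polynomial (ZMod p)) ^ (π b - ℓ i - 1)
  have hξ : ∀ i, ξ (u i) = Polynomial.X ^ (ℓ i + 1) * (1 + Polynomial.X * ρ i) := fun i =>
    codePolyL_eq π hπ (u i) (hne i) (ℓ i) (hℓ i)
  -- the evaluated matrix, columns permuted by `β`, is the block Vandermonde matrix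
  set M : Matrix ι ι (MvPolynomial (Fin h × Option (Fin h)) ℤ) := Matrix.of fun i j : ι =>
      (∏ c ∈ w j, (X (c, none) + ∑ a ∈ u i, X (c, some a)) :
        MvPolynomial (Fin h × Option (Fin h)) ℤ) with hM
  have hmat : (ψ.mapMatrix M).submatrix id β =
      Matrix.of fun i j : ι =>
        (Polynomial.X ^ (ℓ i + 1) * (1 + Polynomial.X * ρ i)) ^ (D (β j)) := by
    refine Matrix.ext fun i j => ?_
    rw [Matrix.submatrix_apply, RingHom.mapMatrix_apply, Matrix.map_apply, hM, Matrix.of_apply,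
      Matrix.of_apply, id, ← hξ i, ← hw (β j)]
    exact frobL_entry Z e π (u i) (w (β j))
  -- the block Vandermonde theorem
  have hblock : (Matrix.of fun i j : ι =>
      (Polynomial.X ^ (ℓ i + 1) * (1 + Polynomial.X * ρ i)) ^ (D (β j))).det ≠ 0 := by
    refine det_pow_ne_zero_of_blocks (ZMod p) (fun i => ℓ i + 1) ρ (fun j => D (β j))
      (fun i => Nat.succ_pos _) (fun i i' h1 h2 => ?_) (hD.comp β.injective) (fun i i' h => ?_)
      (fun i i' h => ?_)
    · apply hu
      apply codePolyL_injective (p := p) π hπ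
      show ξ (u i) = ξ (u i')
      rw [hξ i, hξ i', h2]
      congr 1
      rw [show ℓ i = ℓ i' by omega]
    · exact hlt i i' (by omega)
    · have hc : Fintype.card {k // ℓ k + 1 = ℓ i + 1} = Fintype.card {k // ℓ k = ℓ i} :=
        Fintype.card_congr (Equiv.subtypeEquivRight fun k => by omega)
      rw [hc]
      exact heq i i' (by omega)
  rw [← hmat] at hblock
  have hdetψ : (ψ.mapMatrix M).det ≠ 0 := det_ne_zero_of_submatrix _ (Equiv.refl ι) β hblock
  intro h0
  apply hdetψ
  rw [← RingHom.map_det, h0, map_zero]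

/-- **BLOCK-CONTIGUOUS CERTIFICATE WITH THE EMPTY ROW** `u i₀ = ∅`: it must face the weight-`0` column
(`D (β i₀) = 0`, i.e. `w (β i₀) ⊆ Z`); the block conditions are imposed on the other rows (classes counted
among them). The empty row evaluates to the indicator of that column and is peeled (`det_pow_ne_zero_of_zero_row`). -/
theorem det_additiveZ_ne_zero_of_blockContiguous₀ (p : ℕ) [Fact p.Prime] {ι : Type*} [Fintype ι]
    [DecidableEq ι] (u w : ι → Finset (Fin h)) (hu : Function.Injective u) (i₀ : ι) (hu₀ : u i₀ = ∅)
    (hne : ∀ i, i ≠ i₀ → (u i).Nonempty) (Z : Finset (Fin h)) (e : Fin h → ℕ) (π : Fin h → ℕ)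
    (hπ : Function.Injective π) (D : ι → ℕ) (hw : ∀ j, ∑ c ∈ w j \ Z, p ^ e c = D j)
    (ℓ : ι → ℕ) (hℓ : ∀ i (hi : i ≠ i₀), (u i).inf' (hne i hi) π = ℓ i) (β : ι ≃ ι)
    (hD : Function.Injective D) (hβ₀ : D (β i₀) = 0)
    (hlt : ∀ i i', i ≠ i₀ → i' ≠ i₀ → ℓ i < ℓ i' → D (β i') < D (β i))
    (heq : ∀ i i', i ≠ i₀ → i' ≠ i₀ → ℓ i = ℓ i' →
      D (β i) < D (β i') + Fintype.card {k // k ≠ i₀ ∧ ℓ k = ℓ i}) :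
    (Matrix.of fun i j : ι =>
      (∏ c ∈ w j, (X (c, none) + ∑ a ∈ u i, X (c, some a)) :
        MvPolynomial (Fin h × Option (Fin h)) ℤ)).det ≠ 0 := by
  let ψ : MvPolynomial (Fin h × Option (Fin h)) ℤ →+* Polynomial (ZMod p) :=
    eval₂Hom (Int.castRingHom (Polynomial (ZMod p)))
      (fun q : Fin h × Option (Fin h) =>
        Option.elim q.2 (if q.1 ∈ Z then 1 else 0) fun a =>
          if q.1 ∈ Z then 0 else (Polynomial.X : Polynomial (ZMod p)) ^ ((π a + 1) * p ^ e q.1))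
  let ξ : Finset (Fin h) → Polynomial (ZMod p) := fun U =>
    ∑ b ∈ U, (Polynomial.X : Polynomial (ZMod p)) ^ (π b + 1)
  let ρ : ι → Polynomial (ZMod p) := fun i =>
    ∑ b ∈ (u i).filter (fun b => π b ≠ ℓ i), (Polynomial.X : Polynomial (ZMod p)) ^ (π b - ℓ i - 1)
  have hξ : ∀ i, i ≠ i₀ → ξ (u i) = Polynomial.X ^ (ℓ i + 1) * (1 + Polynomial.X * ρ i) :=
    fun i hi => codePolyL_eq π hπ (u i) (hne i hi) (ℓ i) (hℓ i hi)
  set M : Matrix ι ι (MvPolynomial (Fin h × Option (Fin h)) ℤ) := Matrix.of fun i j : ι =>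
      (∏ c ∈ w j, (X (c, none) + ∑ a ∈ u i, X (c, some a)) :
        MvPolynomial (Fin h × Option (Fin h)) ℤ) with hM
  have hmat : (ψ.mapMatrix M).submatrix id β = Matrix.of fun i j : ι => ξ (u i) ^ (D (β j)) := by
    refine Matrix.ext fun i j => ?_
    rw [Matrix.submatrix_apply, RingHom.mapMatrix_apply, Matrix.map_apply, hM, Matrix.of_apply,
      Matrix.of_apply, id, ← hw (β j)]
    exact frobL_entry Z e π (u i) (w (β j))
  have hpeel : (Matrix.of fun i j : ι => ξ (u i) ^ (D (β j))).det ≠ 0 := by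
    refine det_pow_ne_zero_of_zero_row (fun i => ξ (u i)) (fun j => D (β j)) i₀
      (by simp [ξ, hu₀]) hβ₀ (fun j hj h0 => hj (β.injective (hD (h0.trans hβ₀.symm)))) ?_
    have hmin : (Matrix.of fun i j : {i // i ≠ i₀} => ξ (u i.1) ^ D (β j.1)) =
        Matrix.of fun i j : {i // i ≠ i₀} =>
          (Polynomial.X ^ (ℓ i.1 + 1) * (1 + Polynomial.X * ρ i.1)) ^ D (β j.1) := by
      refine Matrix.ext fun i j => ?_
      rw [Matrix.of_apply, Matrix.of_apply, hξ i.1 i.2]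
    rw [hmin]
    refine det_pow_ne_zero_of_blocks (ZMod p) (fun i : {i // i ≠ i₀} => ℓ i.1 + 1) (fun i => ρ i.1)
      (fun j => D (β j.1)) (fun i => Nat.succ_pos _) (fun i i' h1 h2 => ?_)
      (fun j j' hjj => Subtype.ext (β.injective (hD hjj))) (fun i i' hii => ?_) (fun i i' hii => ?_)
    · apply Subtype.ext
      apply hu
      apply codePolyL_injective (p := p) π hπ
      show ξ (u i.1) = ξ (u i'.1)
      rw [hξ i.1 i.2, hξ i'.1 i'.2, h2]
      congr 1
      rw [show ℓ i.1 = ℓ i'.1 by omega]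
    · exact hlt i.1 i'.1 i.2 i'.2 (by omega)
    · have hc : Fintype.card {k : {i // i ≠ i₀} // ℓ k.1 + 1 = ℓ i.1 + 1} =
          Fintype.card {k // k ≠ i₀ ∧ ℓ k = ℓ i.1} := by
        rw [Fintype.card_congr (Equiv.subtypeSubtypeEquivSubtypeInter (fun k => k ≠ i₀)
          (fun k => ℓ k + 1 = ℓ i.1 + 1))]
        exact Fintype.card_congr (Equiv.subtypeEquivRight fun k => by
          constructor <;> rintro ⟨h1, h2⟩ <;> exact ⟨h1, by omega⟩)
      rw [hc]
      exact heq i.1 i'.1 i.2 i'.2 (by omega)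
  rw [← hmat] at hpeel
  have hdetψ : (ψ.mapMatrix M).det ≠ 0 := det_ne_zero_of_submatrix _ (Equiv.refl ι) β hpeel
  intro h0
  apply hdetψ
  rw [← RingHom.map_det, h0, map_zero]

/-- **MIN-STRATIFIED rows × BLOCK-CONTIGUOUS columns are hit** (`ι`-indexed — e.g. `ι = Fin r`, the item's
indexing; `h ≥ 2`, `b = 5`). -/
theorem partitionMinor_hit_of_blockContiguous (hh : 2 ≤ h) (p : ℕ) [Fact p.Prime] {ι : Type*}
    [Fintype ι] [DecidableEq ι] (u w : ι → Finset (Fin h)) (hu : Function.Injective u)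
    (hne : ∀ i, (u i).Nonempty) (Z : Finset (Fin h)) (e : Fin h → ℕ) (π : Fin h → ℕ)
    (hπ : Function.Injective π) (D : ι → ℕ) (hw : ∀ j, ∑ c ∈ w j \ Z, p ^ e c = D j)
    (ℓ : ι → ℕ) (hℓ : ∀ i, (u i).inf' (hne i) π = ℓ i) (β : ι ≃ ι) (hD : Function.Injective D)
    (hlt : ∀ i i', ℓ i < ℓ i' → D (β i') < D (β i))
    (heq : ∀ i i', ℓ i = ℓ i' → D (β i) < D (β i') + Fintype.card {k // ℓ k = ℓ i}) :
    ∃ f ∈ SmallCircuits ℂ (h + h) 5,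
      (Matrix.of fun i j : ι => MvPolynomial.coeff
        (∑ a ∈ u i, Finsupp.single (Fin.castAdd h a) 1 +
          ∑ c ∈ w j, Finsupp.single (Fin.natAdd h c) 1) f).det ≠ 0 :=
  partitionMinor_hit_of_det_additiveZ_ne_zero hh u w
    (det_additiveZ_ne_zero_of_blockContiguous p u w hu hne Z e π hπ D hw ℓ hℓ β hD hlt heq)

/-- **Hit, with the empty row** (`ι`-indexed; the empty row is matched to the weight-`0` column). -/
theorem partitionMinor_hit_of_blockContiguous₀ (hh : 2 ≤ h) (p : ℕ) [Fact p.Prime] {ι : Type*}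
    [Fintype ι] [DecidableEq ι] (u w : ι → Finset (Fin h)) (hu : Function.Injective u) (i₀ : ι)
    (hu₀ : u i₀ = ∅) (hne : ∀ i, i ≠ i₀ → (u i).Nonempty) (Z : Finset (Fin h)) (e : Fin h → ℕ)
    (π : Fin h → ℕ) (hπ : Function.Injective π) (D : ι → ℕ) (hw : ∀ j, ∑ c ∈ w j \ Z, p ^ e c = D j)
    (ℓ : ι → ℕ) (hℓ : ∀ i (hi : i ≠ i₀), (u i).inf' (hne i hi) π = ℓ i) (β : ι ≃ ι)
    (hD : Function.Injective D) (hβ₀ : D (β i₀) = 0)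
    (hlt : ∀ i i', i ≠ i₀ → i' ≠ i₀ → ℓ i < ℓ i' → D (β i') < D (β i))
    (heq : ∀ i i', i ≠ i₀ → i' ≠ i₀ → ℓ i = ℓ i' →
      D (β i) < D (β i') + Fintype.card {k // k ≠ i₀ ∧ ℓ k = ℓ i}) :
    ∃ f ∈ SmallCircuits ℂ (h + h) 5,
      (Matrix.of fun i j : ι => MvPolynomial.coeff
        (∑ a ∈ u i, Finsupp.single (Fin.castAdd h a) 1 +
          ∑ c ∈ w j, Finsupp.single (Fin.natAdd h c) 1) f).det ≠ 0 :=
  partitionMinor_hit_of_det_additiveZ_ne_zero hh u w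
    (det_additiveZ_ne_zero_of_blockContiguous₀ p u w hu i₀ hu₀ hne Z e π hπ D hw ℓ hℓ β hD hβ₀ hlt heq)

/-- **BLOCK-CONTIGUOUS rows × MIN-STRATIFIED columns are hit** (`x ↔ y` mirror). -/
theorem partitionMinor_hit_of_blockContiguous_rows (hh : 2 ≤ h) (p : ℕ) [Fact p.Prime] {r : ℕ}
    (u w : Fin r → Finset (Fin h)) (hw : Function.Injective w) (hne : ∀ j, (w j).Nonempty)
    (Z : Finset (Fin h)) (e : Fin h → ℕ) (π : Fin h → ℕ) (hπ : Function.Injective π)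
    (D : Fin r → ℕ) (hu : ∀ i, ∑ c ∈ u i \ Z, p ^ e c = D i)
    (ℓ : Fin r → ℕ) (hℓ : ∀ j, (w j).inf' (hne j) π = ℓ j) (β : Equiv.Perm (Fin r))
    (hD : Function.Injective D)
    (hlt : ∀ j j', ℓ j < ℓ j' → D (β j') < D (β j))
    (heq : ∀ j j', ℓ j = ℓ j' → D (β j) < D (β j') + Fintype.card {k // ℓ k = ℓ j}) :
    ∃ f ∈ SmallCircuits ℂ (h + h) 5,
      (Matrix.of fun i j : Fin r => MvPolynomial.coeff
        (∑ a ∈ u i, Finsupp.single (Fin.castAdd h a) 1 +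
          ∑ c ∈ w j, Finsupp.single (Fin.natAdd h c) 1) f).det ≠ 0 :=
  partitionMinor_hit_symm h 5 u w
    (partitionMinor_hit_of_blockContiguous hh p w u hw hne Z e π hπ D hu ℓ hℓ β hD hlt heq)

/-! ## 4. Sorted form (no bijection to supply) -/

/-- Runs in sorted position: if `ℓ` is monotone, `ℓ i = ℓ i'` with `i' = i + n`, and adjacent equal labels force
unit weight steps, then `D i = D i' + n` and the label class of `i` has more than `n` members. -/
theorem sorted_run {r : ℕ} (ℓ D : Fin r → ℕ) (hmono : Monotone ℓ)
    (hstep : ∀ i i' : Fin r, (i' : ℕ) = i + 1 → ℓ i = ℓ i' → D i = D i' + 1) :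
    ∀ (n : ℕ) (i i' : Fin r), (i' : ℕ) = i + n → ℓ i = ℓ i' →
      D i = D i' + n ∧ n < Fintype.card {k // ℓ k = ℓ i} := by
  have hconst : ∀ (i i' k : Fin r), ℓ i = ℓ i' → i ≤ k → k ≤ i' → ℓ k = ℓ i :=
    fun i i' k h hik hki' => le_antisymm (h ▸ hmono hki') (hmono hik)
  intro n
  induction n with
  | zero =>
    intro i i' h _
    have hii' : i' = i := Fin.ext (by omega)
    subst hii'
    exact ⟨by simp, Fintype.card_pos_iff.mpr ⟨⟨i', rfl⟩⟩⟩
  | succ n ih =>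
    intro i i' h hl
    have hi1 : (i : ℕ) + 1 < r := by have := i'.isLt; omega
    set i₁ : Fin r := ⟨i + 1, hi1⟩ with hi₁
    have hl₁ : ℓ i₁ = ℓ i := hconst i i' i₁ hl (Fin.le_def.mpr (by simp [hi₁]))
      (Fin.le_def.mpr (by simp [hi₁]; omega))
    have h1 : D i = D i₁ + 1 := hstep i i₁ (by simp [hi₁]) hl₁.symm
    obtain ⟨h2, -⟩ := ih i₁ i' (by simp [hi₁]; omega) (hl₁.trans hl)
    refine ⟨by omega, ?_⟩
    have hmem : ∀ t : Fin (n + 2), (i : ℕ) + t < r := fun t => by have := i'.isLt; have := t.isLt; omega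
    let f : Fin (n + 2) → {k // ℓ k = ℓ i} := fun t =>
      ⟨⟨i + t, hmem t⟩, hconst i i' _ hl (Fin.le_def.mpr (by simp)) (Fin.le_def.mpr (by simp; omega))⟩
    have hf : Function.Injective f := by
      intro t t' htt'
      have := congrArg (fun x : {k // ℓ k = ℓ i} => (x.1 : ℕ)) htt'
      exact Fin.ext (by simpa [f] using this)
    have := Fintype.card_le_of_injective f hf
    simp only [Fintype.card_fin] at this
    omega

/-- **SORTED BLOCK-CONTIGUOUS CERTIFICATE ⇒ nonsingular.** List the rows by non-decreasing label `ℓ i = min π(u i)`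
and the columns by strictly DEcreasing weight `D j`; if any two ADJACENT rows with the same label face weights
differing by exactly `1`, the integer additive matrix is nonsingular (the bijection is the identity). -/
theorem det_additiveZ_ne_zero_of_blockContiguous_sorted (p : ℕ) [Fact p.Prime] {r : ℕ}
    (u w : Fin r → Finset (Fin h)) (hu : Function.Injective u) (hne : ∀ i, (u i).Nonempty)
    (Z : Finset (Fin h)) (e : Fin h → ℕ) (π : Fin h → ℕ) (hπ : Function.Injective π)
    (D : Fin r → ℕ) (hw : ∀ j, ∑ c ∈ w j \ Z, p ^ e c = D j)
    (ℓ : Fin r → ℕ) (hℓ : ∀ i, (u i).inf' (hne i) π = ℓ i)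
    (hmono : Monotone ℓ) (hanti : StrictAnti D)
    (hstep : ∀ i i' : Fin r, (i' : ℕ) = i + 1 → ℓ i = ℓ i' → D i = D i' + 1) :
    (Matrix.of fun i j : Fin r =>
      (∏ c ∈ w j, (X (c, none) + ∑ a ∈ u i, X (c, some a)) :
        MvPolynomial (Fin h × Option (Fin h)) ℤ)).det ≠ 0 := by
  refine det_additiveZ_ne_zero_of_blockContiguous p u w hu hne Z e π hπ D hw ℓ hℓ (Equiv.refl _)
    hanti.injective (fun i i' h => ?_) (fun i i' h => ?_)
  · have hii' : i < i' := lt_of_not_ge fun hle => absurd (hmono hle) (not_le.mpr h)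
    exact hanti hii'
  · show D i < D i' + Fintype.card {k // ℓ k = ℓ i}
    rcases le_or_gt i' i with hle | hlt'
    · have h1 : D i ≤ D i' := hanti.antitone hle
      have h2 : 0 < Fintype.card {k // ℓ k = ℓ i} := Fintype.card_pos_iff.mpr ⟨⟨i, rfl⟩⟩
      omega
    · obtain ⟨h1, h2⟩ := sorted_run ℓ D hmono hstep ((i' : ℕ) - i) i i'
        (by have := Fin.lt_def.mp hlt'; omega) h
      omega

/-- **SORTED BLOCK-CONTIGUOUS CERTIFICATE ⇒ hit** (`h ≥ 2`, `b = 5`): rows listed by non-decreasing minimal label,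
columns by strictly decreasing `p`-ary weight, adjacent equal labels facing consecutive weights. -/
theorem partitionMinor_hit_of_blockContiguous_sorted (hh : 2 ≤ h) (p : ℕ) [Fact p.Prime] {r : ℕ}
    (u w : Fin r → Finset (Fin h)) (hu : Function.Injective u) (hne : ∀ i, (u i).Nonempty)
    (Z : Finset (Fin h)) (e : Fin h → ℕ) (π : Fin h → ℕ) (hπ : Function.Injective π)
    (D : Fin r → ℕ) (hw : ∀ j, ∑ c ∈ w j \ Z, p ^ e c = D j)
    (ℓ : Fin r → ℕ) (hℓ : ∀ i, (u i).inf' (hne i) π = ℓ i)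
    (hmono : Monotone ℓ) (hanti : StrictAnti D)
    (hstep : ∀ i i' : Fin r, (i' : ℕ) = i + 1 → ℓ i = ℓ i' → D i = D i' + 1) :
    ∃ f ∈ SmallCircuits ℂ (h + h) 5,
      (Matrix.of fun i j : Fin r => MvPolynomial.coeff
        (∑ a ∈ u i, Finsupp.single (Fin.castAdd h a) 1 +
          ∑ c ∈ w j, Finsupp.single (Fin.natAdd h c) 1) f).det ≠ 0 :=
  partitionMinor_hit_of_det_additiveZ_ne_zero hh u w
    (det_additiveZ_ne_zero_of_blockContiguous_sorted p u w hu hne Z e π hπ D hw ℓ hℓ hmono hanti hstep)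

/-- Smoke test, all certificate hypotheses by `decide` (`h = 3`, `p = 2`, `e c = 2 − c`, `π = id`): rows
`{0},{0,2},{1},{1,2}` (labels `0,0,1,1`) × columns `{0,1,2},{0,1},{1,2},{1}` (weights `7,6,3,2`, two runs). -/
example : ∃ f ∈ SmallCircuits ℂ (3 + 3) 5,
    (Matrix.of fun i j : Fin 4 => MvPolynomial.coeff
      (∑ a ∈ (![{0}, {0, 2}, {1}, {1, 2}] : Fin 4 → Finset (Fin 3)) i, Finsupp.single (Fin.castAdd 3 a) 1 +
        ∑ c ∈ (![{0, 1, 2}, {0, 1}, {1, 2}, {1}] : Fin 4 → Finset (Fin 3)) j,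
          Finsupp.single (Fin.natAdd 3 c) 1) f).det ≠ 0 :=
  have : Fact (Nat.Prime 2) := ⟨Nat.prime_two⟩
  partitionMinor_hit_of_blockContiguous_sorted (h := 3) (by norm_num) 2
    (![{0}, {0, 2}, {1}, {1, 2}]) (![{0, 1, 2}, {0, 1}, {1, 2}, {1}]) (by decide) (by decide)
    ∅ (fun c => 2 - (c : ℕ)) (fun c => (c : ℕ)) Fin.val_injective ![7, 6, 3, 2] (by decide)
    ![0, 0, 1, 1] (by decide) (by decide) (by decide) (by decide)

end

end Summit.ValiantsHypothesis.ValiantsHypothesis.Theorems.BarrierLever.SubsetSum
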